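import Literature.MathematicalPhysics.QuantumFieldTheory.King1986.CompositionLaw

/-!
# King 1986, (3.92)–(3.93): the `L^{-2k}` rate of the quadratic form `⟨A_k, Δ^{(k)}A_k⟩` and of the Gaussian
# normalisation `ln N_k`, from Proposition 3.10 — kernel bookkeeping with explicit constants

**Citation header (reproduction of PUBLISHED work; template file of the Bałaban lattice Yang–Mills cell `pub-balaban`,
TEMPLATE.md §18.2 row K2; companion of `King1986/CompositionLaw` (`lemma43_aK` = Prop. 3.10 (3.91) / Lemma 4.3 (4.18)
with explicit constant), `…/CovarianceRate` (K5) and `…/EndpointCoercivity`).**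
C. King, *The U(1) Higgs model. I. The continuum limit*, Commun. Math. Phys. **102** (1986) 649–677 [King1986], §3.6
p. 669: Proposition 3.10 and its two immediate consequences (3.92), (3.93).  Page image read: cell folder
`b2b-balaban-template/king-renders/1986-cmp102-king-u1-higgs-I-p021-x2.png`.  King's paper is TEMPLATE LITERATURE for
the cell, not a manuscript under audit.

**What King prints (verbatim, p. 669).**  *"The operator Δ^{(k)} is diagonal in the Fourier representation on T^{(k)},
and in Sect. 4 we prove the following proposition concerning its Fourier transform Δ^{(k)}(p).
**Proposition 3.10.** |Δ^{(k)}(p)| ≤ C uniformly in k,  |Δ^{(k)}(p) − Δ^{(k+n)}(p)| ≤ CL^{−2k}|Δ^{(k)}(p)|. (3.91)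
From Proposition 3.10 we get immediately  |⟨A_k, (Δ^{(k)} − Δ^{(k+n)})A_k⟩| ≤ CL^{−2k}(p(L^kε))²(μ₀L^kε)^{−2}(L^kε)^{−d}|T|,
(3.92)  where we used the bounds (3.2). Furthermore,  |ln N_k − ln N_{k+n}| = 1/2d |Σ_p ln[Δ^{(k+n)}(p)Δ^{(k)}(p)^{−1}]|
≤ C Σ_p ln[1 + (Δ^{(k+n)}(p) − Δ^{(k)}(p))Δ^{(k)}(p)^{−1}] ≤ C Σ_p L^{−2k} ≤ CL^{−2k}(L^kε)^{−d}|T|. (3.93)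
The convergence of ln N_k(0) follows similarly."*

**What this file PROVES (kernel; abstract finite momentum set `P`, then King's symbols).**
* §1 the one-line real-analysis fact behind (3.93): a RELATIVE rate `|b − a| ≤ θa` with `θ ≤ ½`, `a > 0`, gives
  `|log b − log a| ≤ 2θ` (`abs_log_sub_log_le_of_rel`; from `log x ≤ x − 1` applied to `b/a` and `a/b`).
* §2 (3.93) summed over a finite momentum set (`abs_sum_log_sub_log_le`): `|Σ_p (log Δ₀(p) − log Δ₁(p))| ≤ 2θ·|P|`
  — King's `CΣ_pL^{−2k} ≤ CL^{−2k}(L^kε)^{−d}|T|`, `|P| = (L^kε)^{−d}|T|` = the number of unit-lattice sites = momenta.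
* §3 (3.92) as a statement about Fourier weights (`abs_sum_sub_mul_le`, `king392_shape`): for weights
  `w(p) ≥ 0` (= `|Ω|⁻¹|Ã_k(p)|²`) and a relative rate, `|Σ_p (Δ₁(p) − Δ₀(p))w(p)| ≤ θΣ_pΔ₁(p)w(p) ≤ θ·a·Σ_p w(p)` when
  `Δ₁ ≤ a` (King: `Δ^{(k)} ≤ a_k`, tree `DeltaEff_le`), and `Σ_p w(p) = Σ_x|A_k(x)|² ≤ B²·|P|` (Parseval + the
  small-field bound (3.2), `|A_k| ≤ B = p(L^kε)(μ₀L^kε)⁻¹`) gives `≤ θaB²|P|` (`king392_shape`).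
* §4 King's symbols: with `lemma43_aK` (θ_k = 2a_k(a_n⁻¹ + π²/48 + 1/3)L^{−2k}, tree `…/CompositionLaw`) the
  per-momentum log rate `|log Δ^{(k+n)}(p′) − log Δ^{(k)}(p′)| ≤ 2θ_k` for `p′ ≠ 0` in the Brillouin zone whenever
  `θ_k ≤ ½` (`log_DeltaEff_rate_aK`), and the summed form over any finite family of non-zero zone momenta
  (`king393_aK`): `|Σ (log Δ^{(k+n)} − log Δ^{(k)})| ≤ 2θ_k·|P|`.

**HYPOTHESES / NOT COVERED.**  The identification `ln N_k − ln N_{k+n} = 1/2d Σ_p ln[Δ^{(k+n)}(p)Δ^{(k)}(p)⁻¹]`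
(Gaussian normalisation = `−½ log det` per component, King's first equality in (3.93)) is NOT derived — the file
bounds the printed right-hand side; the zero mode `p′ = 0` is excluded from §4 (there `lemma43_aK` needs `p′ ≠ 0`;
with a mass `M > 0` the zero-mode symbols are `(a_k⁻¹ + M⁻¹)⁻¹`, `(a_{k+n}⁻¹ + M⁻¹)⁻¹` and obey the same relative rate
by `inv_aK_add`, not spelled out); "The convergence of ln N_k(0) follows similarly" is not separately formalised;
the Fourier representation / Parseval and the small-field bound (3.2) enter §3 only as the abstract hypotheses
`0 ≤ w`, `Σ w ≤ B²|P|`.  `A = 0` throughout, as in all of King's §4.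

**How the cell uses this (pointer, not a ruling).**  TEMPLATE §18.2 K2: the Gaussian constants `ln N_k` / `log Z^{(k)}`
of the averaging steps (B12 `N_k`, B10 (6); BETA an2's log-det normalisations) converge at the relative rate of the
effective-Laplacian SYMBOLS — the log costs nothing beyond `θ ≤ ½`.  For Bałaban's background-dependent, gauge-
constrained operators the symbol rate itself is the unprinted input (T4-DAG NE2); nothing here asserts it.  No
`def … : Prop` hypothesis is introduced.  Value = kernel reproduction of a printed `A = 0` consequence with explicit
constants, NOT summit progress.
-/

noncomputable section

open Finset Real
open Literature.MathematicalPhysics.QuantumFieldTheory.Balaban1983to89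

namespace Literature.MathematicalPhysics.QuantumFieldTheory.King1986

/-! ## §1 Relative rate ⇒ log rate -/

/-- `|b − a| ≤ θa`, `θ ≤ ½`, `a > 0` ⇒ `|log b − log a| ≤ 2θ` (from `log x ≤ x − 1` at `b/a` and at `a/b`; the
constant 2 absorbs `1/(1 − θ) ≤ 2`).  This is the step "ln[1 + (Δ^{(k+n)} − Δ^{(k)})Δ^{(k)−1}] ≤ CL^{−2k}" of
(3.93). [folklore] -/
theorem abs_log_sub_log_le_of_rel {a b θ : ℝ} (ha : 0 < a) (hθ : θ ≤ 1 / 2) (h : |b - a| ≤ θ * a) :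
    |Real.log b - Real.log a| ≤ 2 * θ := by
  have hθ0 : 0 ≤ θ := by
    have := (abs_nonneg (b - a)).trans h
    nlinarith
  have hab := abs_le.mp h
  have hb : 0 < b := by nlinarith
  rw [← Real.log_div hb.ne' ha.ne']
  rw [abs_le]
  constructor
  · -- lower bound: log(b/a) = -log(a/b) ≥ -(a/b - 1) ≥ -2θ
    have h1 : Real.log (a / b) ≤ a / b - 1 := Real.log_le_sub_one_of_pos (div_pos ha hb)
    have h2 : Real.log (b / a) = -Real.log (a / b) := by
      rw [Real.log_div hb.ne' ha.ne', Real.log_div ha.ne' hb.ne']; ring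
    have h3 : a / b - 1 ≤ 2 * θ := by
      -- a/b - 1 = (a - b)/b ≤ θa/b and b ≥ (1-θ)a ≥ a/2
      rw [div_sub_one hb.ne', div_le_iff₀ hb]
      nlinarith
    linarith
  · -- upper bound: log(b/a) ≤ b/a - 1 ≤ θ
    have h1 : Real.log (b / a) ≤ b / a - 1 := Real.log_le_sub_one_of_pos (div_pos hb ha)
    have h3 : b / a - 1 ≤ θ := by
      rw [div_sub_one ha.ne', div_le_iff₀ ha]
      linarith
    linarith

/-! ## §2 (3.93): the summed log rate over a finite momentum set -/

section sums

variable {ι : Type*}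

/-- **(3.93) shape.**  If `Δ₁(p) > 0` and `|Δ₀(p) − Δ₁(p)| ≤ θΔ₁(p)` for every `p ∈ P` with `θ ≤ ½`, then
`|Σ_{p∈P} (log Δ₀(p) − log Δ₁(p))| ≤ 2θ·|P|` — King's `≤ CΣ_p L^{−2k} ≤ CL^{−2k}(L^kε)^{−d}|T|`.
[cite: King1986, (3.93) p.669] -/
theorem abs_sum_log_sub_log_le (P : Finset ι) (Δ₁ Δ₀ : ι → ℝ) {θ : ℝ} (hθ : θ ≤ 1 / 2)
    (hpos : ∀ p ∈ P, 0 < Δ₁ p) (hrel : ∀ p ∈ P, |Δ₀ p - Δ₁ p| ≤ θ * Δ₁ p) :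
    |∑ p ∈ P, (Real.log (Δ₀ p) - Real.log (Δ₁ p))| ≤ 2 * θ * P.card := by
  calc |∑ p ∈ P, (Real.log (Δ₀ p) - Real.log (Δ₁ p))|
      ≤ ∑ p ∈ P, |Real.log (Δ₀ p) - Real.log (Δ₁ p)| := Finset.abs_sum_le_sum_abs _ _
    _ ≤ ∑ _p ∈ P, 2 * θ :=
        Finset.sum_le_sum fun p hp => abs_log_sub_log_le_of_rel (hpos p hp) hθ (hrel p hp)
    _ = 2 * θ * P.card := by rw [Finset.sum_const, nsmul_eq_mul]; ring

/-! ## §3 (3.92): the quadratic-form rate as a statement about Fourier weights -/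

/-- **(3.92) shape, first step.**  For nonnegative weights `w(p)` (= `|Ω|⁻¹|Ã_k(p)|²`) and a relative rate
`|Δ₁(p) − Δ₀(p)| ≤ θΔ₁(p)`: `|Σ_p (Δ₁(p) − Δ₀(p))·w(p)| ≤ θ·Σ_p Δ₁(p)w(p)`. [cite: King1986, (3.92) p.669] -/
theorem abs_sum_sub_mul_le (P : Finset ι) (Δ₁ Δ₀ w : ι → ℝ) {θ : ℝ}
    (hw : ∀ p ∈ P, 0 ≤ w p) (hrel : ∀ p ∈ P, |Δ₁ p - Δ₀ p| ≤ θ * Δ₁ p) :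
    |∑ p ∈ P, (Δ₁ p - Δ₀ p) * w p| ≤ θ * ∑ p ∈ P, Δ₁ p * w p := by
  calc |∑ p ∈ P, (Δ₁ p - Δ₀ p) * w p| ≤ ∑ p ∈ P, |(Δ₁ p - Δ₀ p) * w p| := Finset.abs_sum_le_sum_abs _ _
    _ ≤ ∑ p ∈ P, θ * Δ₁ p * w p := by
        refine Finset.sum_le_sum fun p hp => ?_
        rw [abs_mul, abs_of_nonneg (hw p hp)]
        exact mul_le_mul_of_nonneg_right (hrel p hp) (hw p hp)
    _ = θ * ∑ p ∈ P, Δ₁ p * w p := by rw [Finset.mul_sum]; refine Finset.sum_congr rfl fun p _ => ?_; ring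

/-- **(3.92) shape, assembled**: with `Δ₁ ≤ a` (King: `Δ^{(k)} ≤ a_k`) and the field-size input `Σ_p w(p) ≤ B²·|P|`
(Parseval `|Ω|⁻¹Σ_p|Ã_k(p)|² = Σ_x|A_k(x)|²` + the small-field bound (3.2) `|A_k(x)| ≤ B`, `|P|` = number of sites):
`|Σ_p (Δ₁(p) − Δ₀(p))w(p)| ≤ θ·a·B²·|P|` — King's `CL^{−2k}(p(L^kε))²(μ₀L^kε)^{−2}(L^kε)^{−d}|T|` with
`θ = CL^{−2k}`, `B² = (p(L^kε))²(μ₀L^kε)^{−2}`, `|P| = (L^kε)^{−d}|T|`. [cite: King1986, (3.92) p.669] -/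
theorem king392_shape (P : Finset ι) (Δ₁ Δ₀ w : ι → ℝ) {θ a Bsq : ℝ} (hθ : 0 ≤ θ) (ha : 0 ≤ a)
    (hw : ∀ p ∈ P, 0 ≤ w p) (hΔa : ∀ p ∈ P, Δ₁ p ≤ a)
    (hrel : ∀ p ∈ P, |Δ₁ p - Δ₀ p| ≤ θ * Δ₁ p) (hB : ∑ p ∈ P, w p ≤ Bsq * P.card) :
    |∑ p ∈ P, (Δ₁ p - Δ₀ p) * w p| ≤ θ * a * Bsq * P.card := by
  have h1 := abs_sum_sub_mul_le P Δ₁ Δ₀ w hw hrel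
  have h2 : ∑ p ∈ P, Δ₁ p * w p ≤ a * ∑ p ∈ P, w p := by
    rw [Finset.mul_sum]
    exact Finset.sum_le_sum fun p hp => mul_le_mul_of_nonneg_right (hΔa p hp) (hw p hp)
  have h3 : a * ∑ p ∈ P, w p ≤ a * (Bsq * P.card) := mul_le_mul_of_nonneg_left hB ha
  calc |∑ p ∈ P, (Δ₁ p - Δ₀ p) * w p| ≤ θ * ∑ p ∈ P, Δ₁ p * w p := h1
    _ ≤ θ * (a * (Bsq * P.card)) := mul_le_mul_of_nonneg_left (h2.trans h3) hθ
    _ = θ * a * Bsq * P.card := by ring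

end sums

/-! ## §4 King's symbols: the rate `θ_k = 2a_k(a_n⁻¹ + π²/48 + 1/3)L^{−2k}` of `lemma43_aK` -/

section king

variable {dd : ℕ}

/-- King's relative rate constant of Lemma 4.3 with the cell's explicit bookkeeping:
`θ_k = 2a_k(a_n⁻¹ + π²/48 + 1/3)·L^{−2k}` (tree `King1986.lemma43_aK`). [cite: King1986, Lemma 4.3 (4.18) p.672] -/
def thetaK (a : ℝ) (L k n : ℕ) : ℝ :=
  aK a L k * (2 * (((aK a L n)⁻¹ + π ^ 2 / 48 + 1 / 3) * (((L ^ k : ℕ) : ℝ) ^ 2)⁻¹))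

/-- **Per-momentum log rate (the summand of (3.93)).**  For `L ≥ 2`, `k, n ≥ 1`, `a > 0`, `M ≥ 0`, `p′ ≠ 0` in the
Brillouin zone and `θ_k ≤ ½`: `|log Δ^{(k+n)}(p′) − log Δ^{(k)}(p′)| ≤ 2θ_k`. [cite: King1986, (3.93) p.669; (3.91)] -/
theorem log_DeltaEff_rate_aK {a : ℝ} (ha : 0 < a) {L k n : ℕ} (hL : 2 ≤ L) (hk : 1 ≤ k) (hn : 1 ≤ n)
    {M : ℝ} (hM : 0 ≤ M) {p : Fin dd → ℝ} (hp : ∀ μ, |p μ| ≤ π) (hp0 : 0 < momSq p)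
    (hθ : thetaK a L k n ≤ 1 / 2) :
    |Real.log (DeltaEff (aK a L (k + n)) (L ^ n * L ^ k) M p) - Real.log (DeltaEff (aK a L k) (L ^ k) M p)|
      ≤ 2 * thetaK a L k n := by
  have hL1 : (1 : ℝ) < L := by exact_mod_cast hL
  have hN : 1 ≤ L ^ k := Nat.one_le_pow k L (by omega)
  have hpos : 0 < DeltaEff (aK a L k) (L ^ k) M p := DeltaEff_pos (aK_pos ha hL1 hk) hN hM hp hp0
  have h43 := lemma43_aK (dd := dd) ha hL hk hn hM hp hp0
  refine abs_log_sub_log_le_of_rel hpos hθ ?_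
  rw [abs_sub_comm]
  simpa [thetaK, mul_comm, mul_left_comm, mul_assoc] using h43

/-- **(3.93) for King's symbols, summed over any finite family of non-zero zone momenta** (e.g. the dual torus of
`T^{(k)}` minus the zero mode): `|Σ_{p′∈P} (log Δ^{(k+n)}(p′) − log Δ^{(k)}(p′))| ≤ 2θ_k·|P|` — "`≤ CΣ_pL^{−2k} ≤
CL^{−2k}(L^kε)^{−d}|T|`". [cite: King1986, (3.93) p.669] -/
theorem king393_aK {a : ℝ} (ha : 0 < a) {L k n : ℕ} (hL : 2 ≤ L) (hk : 1 ≤ k) (hn : 1 ≤ n)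
    {M : ℝ} (hM : 0 ≤ M) (P : Finset (Fin dd → ℝ)) (hP : ∀ p ∈ P, (∀ μ, |p μ| ≤ π) ∧ 0 < momSq p)
    (hθ : thetaK a L k n ≤ 1 / 2) :
    |∑ p ∈ P, (Real.log (DeltaEff (aK a L (k + n)) (L ^ n * L ^ k) M p)
        - Real.log (DeltaEff (aK a L k) (L ^ k) M p))| ≤ 2 * thetaK a L k n * P.card := by
  calc |∑ p ∈ P, (Real.log (DeltaEff (aK a L (k + n)) (L ^ n * L ^ k) M p)
        - Real.log (DeltaEff (aK a L k) (L ^ k) M p))|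
      ≤ ∑ p ∈ P, |Real.log (DeltaEff (aK a L (k + n)) (L ^ n * L ^ k) M p)
        - Real.log (DeltaEff (aK a L k) (L ^ k) M p)| := Finset.abs_sum_le_sum_abs _ _
    _ ≤ ∑ _p ∈ P, 2 * thetaK a L k n :=
        Finset.sum_le_sum fun p hpP => log_DeltaEff_rate_aK ha hL hk hn hM (hP p hpP).1 (hP p hpP).2 hθ
    _ = 2 * thetaK a L k n * P.card := by rw [Finset.sum_const, nsmul_eq_mul]; ring

/-- **(3.92) for King's symbols**: with Fourier weights `w ≥ 0`, `Σ_p w(p) ≤ B²|P|`, over non-zero zone momenta,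
`|Σ_p (Δ^{(k)}(p′) − Δ^{(k+n)}(p′))w(p′)| ≤ θ_k·a_k·B²·|P|` (uses `Δ^{(k)} ≤ a_k`, tree `DeltaEff_le`).
[cite: King1986, (3.92) p.669] -/
theorem king392_aK {a : ℝ} (ha : 0 < a) {L k n : ℕ} (hL : 2 ≤ L) (hk : 1 ≤ k) (hn : 1 ≤ n)
    {M : ℝ} (hM : 0 ≤ M) (P : Finset (Fin dd → ℝ)) (hP : ∀ p ∈ P, (∀ μ, |p μ| ≤ π) ∧ 0 < momSq p)
    (w : (Fin dd → ℝ) → ℝ) (hw : ∀ p ∈ P, 0 ≤ w p) {Bsq : ℝ} (hB : ∑ p ∈ P, w p ≤ Bsq * P.card) :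
    |∑ p ∈ P, (DeltaEff (aK a L k) (L ^ k) M p - DeltaEff (aK a L (k + n)) (L ^ n * L ^ k) M p) * w p|
      ≤ thetaK a L k n * aK a L k * Bsq * P.card := by
  have hL1 : (1 : ℝ) < L := by exact_mod_cast hL
  have hak : 0 < aK a L k := aK_pos ha hL1 hk
  have hθ0 : 0 ≤ thetaK a L k n := by
    unfold thetaK
    have : 0 < aK a L n := aK_pos ha hL1 hn
    positivity
  refine king392_shape P _ _ w hθ0 hak.le hw
    (fun p _ => DeltaEff_le hak (L ^ k) hM p) (fun p hpP => ?_) hB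
  have h43 := lemma43_aK (dd := dd) ha hL hk hn hM (hP p hpP).1 (hP p hpP).2
  simpa [thetaK, mul_comm, mul_left_comm, mul_assoc] using h43

end king

end Literature.MathematicalPhysics.QuantumFieldTheory.King1986

end
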